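import Summits.BirchSwinnertonDyer.BirchSwinnertonDyer.Theorems.SchneiderFreeAdditiveX3LocalTowerTorsionLine
import HarnessLib

/-!
# Fin_v from TWO complementary stable lines (every prime, `p = 2` included): the local tower torsion is
# finite as soon as `E[p^∞]` is, up to finite index, the sum of two `D_𝔭`-stable subgroups with finite
# intersection, each moved «with bounded kernel» by some element of the local tower group

Cell `bsd-print-cf2`, seat `bsd-line-cf2-p1-w2` g4 (prover, width seat on crux stmt-BirchSwinnertonDyer-20368
`PrintCf2.SplitBadTwoRankOneOfFacts`; lead `bsd-line-cf2-p1` g6, line `eisenstein_two_bdp_line`, skeleton v8 72194fed).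
`--supports stmt-BirchSwinnertonDyer-20368` (helper) toward the registered stub **`stub_finLoc_two`**
(`SchneiderFreeControlAtoms.LocalTowerTorsionFiniteAt (W.baseChange K) 2 κ 𝔭` on the split-bad CM class). ROUTE-FREE
module (imports no `Theses.*`). THEOREMS ONLY (0 definitions, 0 named facts, 0 `sorry`); closes nothing by itself; BSD is
not advanced by any of this; no summit statement is proved by this seat.

WHY. The tree's reductions of Fin_v (`E(K̄)[p^∞]^{D_𝔭 ⊓ ker κ}` finite) run either through ONE canonical `D_𝔭`-stable line
modulo which some element acts as `−1` (`SchneiderFreeAdditiveX3LocalTowerTorsionLine`: the step «`2m ∈ C ⟹ m ∈ C`» needs `p`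
ODD), or through the absence of stable lines (`LocalTowerTorsionFiniteOfNoStableDivisibleLine`, potentially supersingular primes).
On the class of crux 20368 (`49a1^{(d)}`, CM by `K₀ = ℚ(√−7)`, `2` split in `K₀`, `K_𝔭 = ℚ₂ ⊇ K₀`) NEITHER applies at `p = 2`:
the prime is potentially ORDINARY (there are stable lines) and `p = 2`. But the CM action is defined over `K₀ ⊆ ℚ₂`, so
`E[2^∞]|_{D_𝔭}` is — up to finite index — the SUM of the two CM eigen-lines `C₁ ⊕ C₂` (characters `η·χ_d` and
`ε·η⁻¹·χ_d`, `η` unramified with `η(Frob) = u₀` the `2`-adic unit root of `X² − X + 2`, `a₂(49a1) = 1`), and the anticyclotomic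
norm-residue element `σ₀` of `π̄²/2^h` (`𝔭̄^h = (π̄)`) moves BOTH lines: `u₀^h ≠ ±1` and `2^{2h}·u₀^{−h} ≠ ±π_𝔭²` by archimedean size
(`|u₀| = √2`). THIS FILE is the kernel form of the abstract step, valid at every prime:

* §1 `finite_fixedPoints_of_twoStableLines` (generic): `M` a `p`-primary abelian group with finite layers `M[p^k]` and an action of
  `Γ_K`; `N ≤ Γ_K`; `C₁, C₂ ≤ M` with `C₁ ⊓ C₂` of bounded exponent and `p^k·M ⊆ C₁ + C₂`; for `i = 1, 2` an element `g_i ∈ N`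
  preserving `C₁` and `C₂` such that `g_i − 1` has BOUNDED KERNEL EXPONENT on `C_i` (`p^j (g_i x − x) = 0 ⟹ p^{j+e_i} x = 0`).
  Then the `N`-fixed points of `M` are finite: for fixed `m`, `p^k m = c₁ + c₂` and `g_i c_i − c_i ∈ C₁ ⊓ C₂`, so `c₁`, `c₂`,
  hence `m`, have bounded order.
* §1b `boundedKernel_of_smul_eq_intCast` — the bounded-kernel clause from a SCALAR action: if `g` acts on `C` as multiplication
  by an integer `a` with `a − 1 = p^e·u`, `p ∤ u`, then `p^j (g x − x) = 0 ⟹ p^{j+e} x = 0` on `C` (Bézout).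
* §2 **`WeierstrassCurve.localTowerTorsionFiniteAt_of_twoStableLines`** — the curve: `M = E(K̄)[p^∞]`, `N = D_𝔭 ⊓ ker κ`;
  conclusion = the route predicate `SchneiderFreeControlAtoms.LocalTowerTorsionFiniteAt E p κ 𝔭`.
So `stub_finLoc_two` is reduced to SUPPLYING, for `W.baseChange K` at a degree-one `𝔭 ∣ 2`, the two CM lines with one moving
element each (the residual, class-field-theoretic / CM input; see the seat's NOTES for the weights). Nothing here asserts that input.

References: [GreenbergLNM1716] §3 Lemma 3.3 (p. 87); [JetchevSkinnerWan2017] Prop. 3.3.4 Case 3(b) (arXiv:1512.06894 p. 13);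
[SerreTate1968] §4 Thm. 6 (the CM character and its local components) — background for the intended instance.
-/

noncomputable section

open scoped Classical

namespace Summit.BirchSwinnertonDyer.BirchSwinnertonDyer.Theorems.LocalTowerTorsionTwoLines

open NumberField IsDedekindDomain Field WeierstrassCurve
  Literature.NumberTheory.EllipticCurves Literature.NumberTheory.EllipticCurves.GreenbergSelmer
  Literature.NumberTheory.GaloisRepresentations
  Summit.BirchSwinnertonDyer.Rank1Residual.X11b

set_option linter.dupNamespace false
set_option autoImplicit false

variable {K : Type} [Field K] {p : ℕ}

/-! ## §1. Generic: fixed points are finite when the module is two stable lines up to finite index -/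

section Generic

variable {M : Type} [AddCommGroup M] [DistribMulAction (absoluteGaloisGroup K) M]

/-- **Bézout: multiplication by an integer prime to `p` does not lower the `p`-power order.** If `p^n x = 0` would follow from
`p^n (u • x) = 0` whenever `u` is prime to `p` — stated as: `p^n • (u • x) = 0 ⟹ p^n • x = 0` for `x` in a `p`-primary group.
[folklore] -/
theorem pow_smul_eq_zero_of_pow_smul_zsmul_eq_zero (hp : p.Prime) {u : ℤ} (hu : ¬ (p : ℤ) ∣ u) {x : M}
    (hx : ∃ k : ℕ, p ^ k • x = 0) {n : ℕ} (h : p ^ n • (u • x) = 0) : p ^ n • x = 0 := by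
  obtain ⟨k, hk⟩ := hx
  -- `1 = s u + t p^k`
  have hpi : Irreducible (p : ℤ) := (Nat.prime_iff_prime_int.mp hp).irreducible
  have hcop : IsCoprime u ((p : ℤ) ^ k) := (hpi.coprime_iff_not_dvd.mpr hu).symm.pow_right
  obtain ⟨s, t, hst⟩ := hcop
  have hx1 : x = s • (u • x) + t • ((p : ℤ) ^ k • x) := by
    rw [smul_smul, smul_smul, ← add_smul, hst, one_smul]
  have hpk : (p : ℤ) ^ k • x = 0 := by
    rw [show ((p : ℤ) ^ k) = ((p ^ k : ℕ) : ℤ) by push_cast; rfl, natCast_zsmul, hk]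
  rw [hx1, hpk, smul_zero, add_zero, smul_comm, h, smul_zero]

/-- **§1b. The bounded-kernel clause from a scalar action.** If `g` acts on the subgroup `C` of a `p`-primary `Γ_K`-module as
multiplication by an integer `a` (`g • c = a • c`), and `a − 1 = p^e · u` with `p ∤ u`, then `g − 1` has kernel exponent `≤ e` on `C`
in the graded sense: `p^j • (g • x − x) = 0 ⟹ p^{j+e} • x = 0`. (For the CM lines of the intended instance `a` is a truncation of the
character value `χ_i(σ₀) ∈ ℤ_p^×`, `≠ 1`.) [folklore] -/
theorem boundedKernel_of_smul_eq_intCast (hp : p.Prime) (C : AddSubgroup M) {g : absoluteGaloisGroup K} {a : ℤ} {e : ℕ} {u : ℤ}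
    (hga : ∀ c ∈ C, g • c = a • c) (hau : a - 1 = (p : ℤ) ^ e * u) (hu : ¬ (p : ℤ) ∣ u)
    (htor : ∀ m : M, ∃ k : ℕ, p ^ k • m = 0) :
    ∀ x ∈ C, ∀ j : ℕ, p ^ j • (g • x - x) = 0 → p ^ (j + e) • x = 0 := by
  intro x hx j hj
  have hgx : g • x - x = (a - 1) • x := by rw [hga x hx, sub_smul, one_smul]
  rw [hgx, hau, mul_smul, show ((p : ℤ) ^ e) = ((p ^ e : ℕ) : ℤ) by push_cast; rfl, natCast_zsmul,
    smul_smul, ← pow_add] at hj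
  exact pow_smul_eq_zero_of_pow_smul_zsmul_eq_zero hp hu (htor x) hj

/-- **§1. Fixed points are finite when the module is, up to finite index, two stable lines each moved with bounded kernel.**
`M` a `Γ_K`-module whose layers `M[p^k]` are finite; `N ≤ Γ_K`; `C₁, C₂ ≤ M` with `C₁ ⊓ C₂` killed by `p^f` and `p^k·M ⊆ C₁ + C₂`;
for each `i` an element `g_i ∈ N` preserving BOTH `C₁` and `C₂` with `g_i − 1` of bounded kernel exponent `e_i` on `C_i`. Then
`{m | ∀ g ∈ N, g m = m}` is finite — indeed killed by `p^{k + (f+e₁) + (f+e₂)}`: writing `p^k m = c₁ + c₂`, invariance under `g₁`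
gives `g₁c₁ − c₁ = c₂ − g₁c₂ ∈ C₁ ⊓ C₂`, so `p^f(g₁c₁ − c₁) = 0` and `p^{f+e₁} c₁ = 0`; symmetrically `p^{f+e₂} c₂ = 0`. No parity
hypothesis on `p`. [cite: GreenbergLNM1716, §3 Lemma 3.3 (p. 87) (the fixed-point principle; this two-line form is elementary)] -/
theorem finite_fixedPoints_of_twoStableLines (N : Subgroup (absoluteGaloisGroup K))
    (hfin : ∀ k : ℕ, Set.Finite {m : M | p ^ k • m = 0})
    (C₁ C₂ : AddSubgroup M)
    (hmeet : ∃ f : ℕ, ∀ x ∈ C₁, x ∈ C₂ → p ^ f • x = 0)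
    (hsum : ∃ k : ℕ, ∀ m : M, p ^ k • m ∈ C₁ ⊔ C₂)
    (hg₁ : ∃ g ∈ N, (∀ c ∈ C₁, g • c ∈ C₁) ∧ (∀ c ∈ C₂, g • c ∈ C₂) ∧
      ∃ e : ℕ, ∀ x ∈ C₁, ∀ j : ℕ, p ^ j • (g • x - x) = 0 → p ^ (j + e) • x = 0)
    (hg₂ : ∃ g ∈ N, (∀ c ∈ C₁, g • c ∈ C₁) ∧ (∀ c ∈ C₂, g • c ∈ C₂) ∧
      ∃ e : ℕ, ∀ x ∈ C₂, ∀ j : ℕ, p ^ j • (g • x - x) = 0 → p ^ (j + e) • x = 0) :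
    Set.Finite {m : M | ∀ g ∈ N, g • m = m} := by
  obtain ⟨f, hf⟩ := hmeet
  obtain ⟨k, hk⟩ := hsum
  obtain ⟨g₁, hg₁N, h₁₁, h₁₂, e₁, he₁⟩ := hg₁
  obtain ⟨g₂, hg₂N, h₂₁, h₂₂, e₂, he₂⟩ := hg₂
  refine (hfin (k + ((f + e₁) + (f + e₂)))).subset ?_
  intro m hm
  change ∀ g ∈ N, g • m = m at hm
  change p ^ (k + ((f + e₁) + (f + e₂))) • m = 0
  obtain ⟨c₁, hc₁, c₂, hc₂, hsum'⟩ := AddSubgroup.mem_sup.mp (hk m)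
  -- invariance of `p^k m = c₁ + c₂` under `g ∈ N`
  have hinv : ∀ g ∈ N, g • c₁ + g • c₂ = c₁ + c₂ := fun g hg ↦ by
    rw [← smul_add, hsum', smul_comm, hm g hg]
  -- `c₁` has bounded order, through `g₁`
  have hc₁ord : p ^ (f + e₁) • c₁ = 0 := by
    have hy₁ : g₁ • c₁ - c₁ ∈ C₁ := C₁.sub_mem (h₁₁ c₁ hc₁) hc₁
    have hy₂ : g₁ • c₁ - c₁ ∈ C₂ := by
      have heq : g₁ • c₁ - c₁ = c₂ - g₁ • c₂ := by
        have h := hinv g₁ hg₁N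
        rw [sub_eq_sub_iff_add_eq_add, h, add_comm]
      rw [heq]
      exact C₂.sub_mem hc₂ (h₁₂ c₂ hc₂)
    exact he₁ c₁ hc₁ f (hf _ hy₁ hy₂)
  -- `c₂` has bounded order, through `g₂`
  have hc₂ord : p ^ (f + e₂) • c₂ = 0 := by
    have hy₂ : g₂ • c₂ - c₂ ∈ C₂ := C₂.sub_mem (h₂₂ c₂ hc₂) hc₂
    have hy₁ : g₂ • c₂ - c₂ ∈ C₁ := by
      have heq : g₂ • c₂ - c₂ = c₁ - g₂ • c₁ := by
        have h := hinv g₂ hg₂N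
        rw [sub_eq_sub_iff_add_eq_add, add_comm, h]
      rw [heq]
      exact C₁.sub_mem hc₁ (h₂₁ c₁ hc₁)
    exact he₂ c₂ hc₂ f (hf _ hy₁ hy₂)
  -- hence `m` has bounded order
  have h1 : p ^ ((f + e₁) + (f + e₂)) • c₁ = 0 := by
    rw [pow_add, mul_comm, mul_smul, hc₁ord, smul_zero]
  have h2 : p ^ ((f + e₁) + (f + e₂)) • c₂ = 0 := by
    rw [pow_add, mul_smul, hc₂ord, smul_zero]
  rw [pow_add, mul_comm, mul_smul, ← hsum', smul_add, h1, h2, add_zero]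

end Generic

/-! ## §2. The curve: Fin_v at `(E, p, κ, 𝔭)` from two stable lines of `E(K̄)[p^∞]` -/

section Curve

variable [NumberField K] [hp : Fact p.Prime] (E : WeierstrassCurve K) (κ : ZpExtension K p)
  (𝔭 : HeightOneSpectrum (𝓞 K))

/-- **Fin_v from two complementary `D_𝔭`-stable lines (every prime `p`, in particular `p = 2`).** For an elliptic curve `E` over a
number field `K`, a prime `p`, any `ℤ_p`-extension `κ` and finite place `𝔭` (`D_𝔭 = decomp 𝔭`): IF `E(K̄)[p^∞]` contains subgroups
`C₁, C₂` with `C₁ ⊓ C₂` of bounded exponent and `p^k·E[p^∞] ⊆ C₁ + C₂`, and for `i = 1, 2` some `g_i` in the local tower group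
`D_𝔭 ⊓ ker κ` preserves both and has `g_i − 1` of bounded kernel exponent on `C_i`, THEN `E(K̄)[p^∞]^{D_𝔭 ⊓ ker κ}` is finite
(`SchneiderFreeControlAtoms.LocalTowerTorsionFiniteAt E p κ 𝔭`, the route's Fin_v / the line's `stub_finLoc_two` currency). Intended
instance: a CM curve whose CM field embeds in `K_𝔭` (the two CM eigen-lines) at a potentially ordinary `p = 2`, with `g₁ = g₂` the
anticyclotomic norm-residue element. [cite: GreenbergLNM1716, §3 Lemma 3.3 (p. 87)]
[cite: JetchevSkinnerWan2017, Prop. 3.3.4 Case 3(b) (arXiv:1512.06894 p. 13) (the role of Fin_v)] -/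
theorem _root_.WeierstrassCurve.localTowerTorsionFiniteAt_of_twoStableLines [E.IsElliptic]
    (C₁ C₂ : AddSubgroup (E.geomPrimaryTorsion p))
    (hmeet : ∃ f : ℕ, ∀ x ∈ C₁, x ∈ C₂ → p ^ f • x = 0)
    (hsum : ∃ k : ℕ, ∀ m : E.geomPrimaryTorsion p, p ^ k • m ∈ C₁ ⊔ C₂)
    (hg₁ : ∃ g ∈ decomp 𝔭 ⊓ κ.kerSubgroup, (∀ c ∈ C₁, g • c ∈ C₁) ∧ (∀ c ∈ C₂, g • c ∈ C₂) ∧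
      ∃ e : ℕ, ∀ x ∈ C₁, ∀ j : ℕ, p ^ j • (g • x - x) = 0 → p ^ (j + e) • x = 0)
    (hg₂ : ∃ g ∈ decomp 𝔭 ⊓ κ.kerSubgroup, (∀ c ∈ C₁, g • c ∈ C₁) ∧ (∀ c ∈ C₂, g • c ∈ C₂) ∧
      ∃ e : ℕ, ∀ x ∈ C₂, ∀ j : ℕ, p ^ j • (g • x - x) = 0 → p ^ (j + e) • x = 0) :
    SchneiderFreeControlAtoms.LocalTowerTorsionFiniteAt E p κ 𝔭 := by
  unfold SchneiderFreeControlAtoms.LocalTowerTorsionFiniteAt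
  have hset : (FixedPoints.addSubgroup ↥(decomp 𝔭 ⊓ κ.kerSubgroup) (E.geomPrimaryTorsion p) :
      Set (E.geomPrimaryTorsion p)) = {m | ∀ g ∈ decomp 𝔭 ⊓ κ.kerSubgroup, g • m = m} := by
    ext m
    rw [SetLike.mem_coe, FixedPoints.mem_addSubgroup]
    constructor
    · intro h g hg
      exact h ⟨g, hg⟩
    · rintro h ⟨g, hg⟩
      exact h g hg
  rw [hset]
  exact finite_fixedPoints_of_twoStableLines (decomp 𝔭 ⊓ κ.kerSubgroup)
    (AcSelmer.finite_setOf_geomPrimaryTorsion_pow_smul_eq_zero E hp.out.ne_zero) C₁ C₂ hmeet hsum hg₁ hg₂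

/-- **The same with SCALAR actions** (the form in which the CM instance is fed): `g_i` acts on `C_i` as an integer `a_i` with
`a_i − 1 = p^{e_i}·u_i`, `p ∤ u_i`. [cite: GreenbergLNM1716, §3 Lemma 3.3 (p. 87)] -/
theorem _root_.WeierstrassCurve.localTowerTorsionFiniteAt_of_twoStableLines_of_scalars [E.IsElliptic]
    (C₁ C₂ : AddSubgroup (E.geomPrimaryTorsion p))
    (hmeet : ∃ f : ℕ, ∀ x ∈ C₁, x ∈ C₂ → p ^ f • x = 0)
    (hsum : ∃ k : ℕ, ∀ m : E.geomPrimaryTorsion p, p ^ k • m ∈ C₁ ⊔ C₂)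
    {g₁ g₂ : absoluteGaloisGroup K} (hg₁N : g₁ ∈ decomp 𝔭 ⊓ κ.kerSubgroup) (hg₂N : g₂ ∈ decomp 𝔭 ⊓ κ.kerSubgroup)
    (h₁₁ : ∀ c ∈ C₁, g₁ • c ∈ C₁) (h₁₂ : ∀ c ∈ C₂, g₁ • c ∈ C₂) (h₂₁ : ∀ c ∈ C₁, g₂ • c ∈ C₁) (h₂₂ : ∀ c ∈ C₂, g₂ • c ∈ C₂)
    {a₁ a₂ u₁ u₂ : ℤ} {e₁ e₂ : ℕ}
    (ha₁ : ∀ c ∈ C₁, g₁ • c = a₁ • c) (hau₁ : a₁ - 1 = (p : ℤ) ^ e₁ * u₁) (hu₁ : ¬ (p : ℤ) ∣ u₁)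
    (ha₂ : ∀ c ∈ C₂, g₂ • c = a₂ • c) (hau₂ : a₂ - 1 = (p : ℤ) ^ e₂ * u₂) (hu₂ : ¬ (p : ℤ) ∣ u₂) :
    SchneiderFreeControlAtoms.LocalTowerTorsionFiniteAt E p κ 𝔭 := by
  have htor : ∀ m : E.geomPrimaryTorsion p, ∃ k : ℕ, p ^ k • m = 0 := fun x ↦ by
    obtain ⟨k, hk⟩ := x.2
    exact ⟨k, Subtype.ext (by rw [AddSubgroupClass.coe_nsmul, hk]; rfl)⟩
  exact E.localTowerTorsionFiniteAt_of_twoStableLines κ 𝔭 C₁ C₂ hmeet hsum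
    ⟨g₁, hg₁N, h₁₁, h₁₂, e₁, boundedKernel_of_smul_eq_intCast hp.out C₁ ha₁ hau₁ hu₁ htor⟩
    ⟨g₂, hg₂N, h₂₁, h₂₂, e₂, boundedKernel_of_smul_eq_intCast hp.out C₂ ha₂ hau₂ hu₂ htor⟩

end Curve

/-! ## §3. The FILTRATION form (one stable line, sub- and quotient-movers) — appended by the same seat

For a potentially ORDINARY prime the canonical datum is a single `D_𝔭`-stable line `C` (the formal-group torsion of the good
twist) rather than two complementary lines; the CM splitting is not needed. The same counting gives Fin_v from ONE line with an
element of the local tower group moving the QUOTIENT `M ⧸ C` with bounded kernel and one moving `C` with bounded kernel — no parity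
hypothesis on `p` (the odd-`p` file `…LocalTowerTorsionLine` used an element acting as `−1` on `M ⧸ C`, i.e. kernel exponent `0` on
the quotient for `p` odd, which is the special case `e₁ = 0`). -/

section Filtration

variable {M : Type} [AddCommGroup M] [DistribMulAction (absoluteGaloisGroup K) M]

/-- **§3 (generic). Fixed points are finite from ONE stable line with bounded-kernel movers on the line and on the quotient.**
`M` with finite layers `M[p^k]`; `N ≤ Γ_K`; `C ≤ M`; `g₁ ∈ N` with `g₁ − 1` of bounded kernel exponent `e₁` on `M ⧸ C`
(`p^j (g₁ x − x) ∈ C ⟹ p^{j+e₁} x ∈ C`), `g₂ ∈ N` with `g₂ − 1` of bounded kernel exponent `e₂` on `C`. Then every `N`-fixed `m` has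
`p^{e₁} m ∈ C` (take `j = 0`: `g₁ m − m = 0 ∈ C`) and then `p^{e₁+e₂} m = 0` (`g₂` fixes `p^{e₁} m ∈ C`), so the fixed points lie in
`M[p^{e₁+e₂}]`. [cite: GreenbergLNM1716, §3 Lemma 3.3 (p. 87) (the fixed-point principle; this form is elementary)] -/
theorem finite_fixedPoints_of_stableLine_quotient (N : Subgroup (absoluteGaloisGroup K))
    (hfin : ∀ k : ℕ, Set.Finite {m : M | p ^ k • m = 0}) (C : AddSubgroup M)
    (hg₁ : ∃ g ∈ N, ∃ e : ℕ, ∀ x : M, ∀ j : ℕ, p ^ j • (g • x - x) ∈ C → p ^ (j + e) • x ∈ C)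
    (hg₂ : ∃ g ∈ N, ∃ e : ℕ, ∀ x ∈ C, ∀ j : ℕ, p ^ j • (g • x - x) = 0 → p ^ (j + e) • x = 0) :
    Set.Finite {m : M | ∀ g ∈ N, g • m = m} := by
  obtain ⟨g₁, hg₁N, e₁, he₁⟩ := hg₁
  obtain ⟨g₂, hg₂N, e₂, he₂⟩ := hg₂
  refine (hfin (e₁ + e₂)).subset ?_
  intro m hm
  change ∀ g ∈ N, g • m = m at hm
  change p ^ (e₁ + e₂) • m = 0
  -- `p^{e₁} m ∈ C`
  have h1 : p ^ e₁ • m ∈ C := by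
    have h := he₁ m 0 (by rw [hm g₁ hg₁N, sub_self, smul_zero]; exact C.zero_mem)
    rwa [zero_add] at h
  -- `g₂` fixes `p^{e₁} m`, so `p^{e₂} (p^{e₁} m) = 0`
  have h2 : p ^ (0 + e₂) • (p ^ e₁ • m) = 0 :=
    he₂ _ h1 0 (by rw [smul_comm, hm g₂ hg₂N, sub_self, smul_zero])
  rw [zero_add, smul_smul, ← pow_add, add_comm] at h2
  exact h2

end Filtration

section CurveFiltration

variable [NumberField K] [hp : Fact p.Prime] (E : WeierstrassCurve K) (κ : ZpExtension K p)
  (𝔭 : HeightOneSpectrum (𝓞 K))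

/-- **Fin_v from ONE `D_𝔭`-stable line with sub- and quotient-movers (every prime `p`).** For `C ≤ E(K̄)[p^∞]`: IF some
`g₁ ∈ D_𝔭 ⊓ ker κ` has `g₁ − 1` of bounded kernel exponent on `E[p^∞] ⧸ C` and some `g₂ ∈ D_𝔭 ⊓ ker κ` has `g₂ − 1` of bounded kernel
exponent on `C`, THEN `SchneiderFreeControlAtoms.LocalTowerTorsionFiniteAt E p κ 𝔭`. Intended instance at a potentially ordinary prime
(any `p`, in particular the split-bad CM class at `2`): `C` = the formal-group line of the good twist, quotient character `η·χ` (unramified ·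
finite), sub character `ε·η⁻¹·χ`, `g₁ = g₂` the anticyclotomic norm-residue element `σ₀` (`η(σ₀) = u₀^h`, `u₀` the unit root — never a root of
unity). [cite: GreenbergLNM1716, §3 Lemma 3.3 (p. 87)] [cite: JetchevSkinnerWan2017, Prop. 3.3.4 Case 3(b) (arXiv:1512.06894 p. 13)] -/
theorem _root_.WeierstrassCurve.localTowerTorsionFiniteAt_of_stableLine_quotient [E.IsElliptic]
    (C : AddSubgroup (E.geomPrimaryTorsion p))
    (hg₁ : ∃ g ∈ decomp 𝔭 ⊓ κ.kerSubgroup, ∃ e : ℕ, ∀ x : E.geomPrimaryTorsion p, ∀ j : ℕ,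
      p ^ j • (g • x - x) ∈ C → p ^ (j + e) • x ∈ C)
    (hg₂ : ∃ g ∈ decomp 𝔭 ⊓ κ.kerSubgroup, ∃ e : ℕ, ∀ x ∈ C, ∀ j : ℕ,
      p ^ j • (g • x - x) = 0 → p ^ (j + e) • x = 0) :
    SchneiderFreeControlAtoms.LocalTowerTorsionFiniteAt E p κ 𝔭 := by
  unfold SchneiderFreeControlAtoms.LocalTowerTorsionFiniteAt
  have hset : (FixedPoints.addSubgroup ↥(decomp 𝔭 ⊓ κ.kerSubgroup) (E.geomPrimaryTorsion p) :
      Set (E.geomPrimaryTorsion p)) = {m | ∀ g ∈ decomp 𝔭 ⊓ κ.kerSubgroup, g • m = m} := by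
    ext m
    rw [SetLike.mem_coe, FixedPoints.mem_addSubgroup]
    constructor
    · intro h g hg
      exact h ⟨g, hg⟩
    · rintro h ⟨g, hg⟩
      exact h g hg
  rw [hset]
  exact finite_fixedPoints_of_stableLine_quotient (decomp 𝔭 ⊓ κ.kerSubgroup)
    (AcSelmer.finite_setOf_geomPrimaryTorsion_pow_smul_eq_zero E hp.out.ne_zero) C hg₁ hg₂

end CurveFiltration

end Summit.BirchSwinnertonDyer.BirchSwinnertonDyer.Theorems.LocalTowerTorsionTwoLines

end
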